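import Literature.NumberTheory.Irrationality.Lai2025TwoAdic.PhiRefinement
import Literature.NumberTheory.DiophantineApproximation.PrimeFractionalPartClasses
import HarnessLib

/-!
# Lai 2025 (IJNT), Lemma 5.1 (lower half): `Φ_n ≥ e^{n/4}` for all large `n` — PROVED

Topic `Literature/NumberTheory/Irrationality/Lai2025TwoAdic`.  Source: L. Lai, *On the irrationality of certain `2`-adic
zeta values*, Int. J. Number Theory (2025) = arXiv:2304.00816 [Lai2025TwoAdicZeta], Lemma 5.1 and its proof (held text
`paper:arxiv-2304.00816`, chunk p0010, read on the page).  PROOF FILE (theorems only; no definition, no named fact).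
File 4 of the discharge of `PAdicZetaValues.lai2025TwoAdic_theorem12` (Theorem 1.2, the `A_n` family); input:
`PhiRefinement.lean` (`phiPrimes`, `PhiL` = the factor `Φ_n` of (def_Phi)) and the tree's prime number theorem on one
class `(θ(n/(k+u)) − θ(n/(k+v)))/n → 1/(k+u) − 1/(k+v)` (`DiophantineApproximation.RhinViola.tendsto_theta_class_div`).

## Source, as printed ([Lai2025TwoAdicZeta, Lemma 5.1])

**Lemma 5.1.** «We have the following asymptotic estimate of the factor `Φ_n` defined in (def_Phi):
`|Φ_n| = exp((2 log 2 − 1 + o(1))n)` as `n → ∞`.»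

*Proof (printed).* «By the prime number theory, we know that `Σ_{q ≤ Y} log q = (1+o(1))Y` as `Y → ∞`.  We have
`log Φ_n = Σ_{√(10n) < q ≤ n, {n/q} > ½} log q = Σ_{q ≤ n, {n/q} > ½} log q + O(√n)`.  It suffices to show that
`L_n := Σ_{q ≤ n, {n/q} > ½} log q = (2 log 2 − 1 + o(1))n`.  In fact, we have
`L_n = Σ_{k=1}^{∞} Σ_{k+½ < n/q < k+1} log q = Σ_{k=1}^{∞} Σ_{n/(k+1) < q < n/(k+½)} log q`.  It follows that for every integer
`K ≥ 2` we have `Σ_{k=1}^{K} Σ_{n/(k+1) < q < n/(k+½)} log q ≤ L_n ≤ Σ_{k=1}^{K} Σ_{n/(k+1) < q < n/(k+½)} log q + Σ_{q < n/(K+3/2)} log q`.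
Then (PNT) implies that `n Σ_{k=1}^{K} (1/(k+½) − 1/(k+1)) + o(n) ≤ L_n ≤ n Σ_{k=1}^{K}(1/(k+½) − 1/(k+1)) + n/(K+3/2) + o(n)`.
Letting `K → ∞` we obtain `L_n = n Σ_{k=1}^{∞}(1/(k+½) − 1/(k+1)) + o(n) = (2 log 2 − 1)n + o(n)`, as desired.»

## What is formalised (all PROVED) and how it deviates

Only the LOWER half of the printed sandwich is needed for Theorem 1.2 (the factor `Φ_n^{−(s+2)}` only has to be small),
and with the printed `K = 3`: the three classes `n/(k+1) < q ≤ n/(k+½)`, `k = 1, 2, 3`, consist of primes of `Φ_n` as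
soon as `n ≥ 161` (`mem_phiPrimes_of_class`: then `q > n/4 > √(10n)`, `q ≤ 2n/3 ≤ n`, and `{n/q} = n/q − k ∈ [½, 1)`
with `½` excluded because `q` is odd), so `log Φ_n ≥ Σ_{k=1}^{3} (θ(n/(k+½)) − θ(n/(k+1)))` (`sum_classes_le_log_PhiL`),
and by the prime number theorem on each class the right-hand side is `(1/6 + 1/15 + 1/28 + o(1))n = (113/420 + o(1))n`
(`tendsto_sum_classes_div`).  Since `113/420 > 1/4`:

**Theorem** (`eventually_exp_le_PhiL`). `e^{n/4} ≤ Φ_n` for all sufficiently large `n`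
(and `eventually_exp_mul_le_PhiL_pow`: `e^{an/4} ≤ Φ_n^a`).

The full constant `2 log 2 − 1 = 0.386…` (all classes, upper half, the `O(√n)` cut-off) is proved in the companion file
`PhiRate.lean` (`tendsto_log_PhiL_div`, on the tree's window engine `Hata1992.fracProd`); the weaker rate `¼` proved
here by hand suffices for Theorem 1.2 because `(4s+8) log 2 > 2.75 s + 5.25` (see `HurwitzParityWindowIrrational.lean`).

Cell zeta5-irr / pub-zeta5 (HONEST FRAMING): an auxiliary prime-number-theorem estimate of a PUBLISHED proof
[Lai2025TwoAdicZeta]; nothing here bears on `ζ(5) ∈ ℝ`.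
-/

noncomputable section

open Finset Filter Topology
open Literature.NumberTheory.Transcendental
open Literature.NumberTheory.DiophantineApproximation

namespace Literature.NumberTheory.Irrationality.Lai2025TwoAdic

/-! ## §1. The classes `n/(k+1) < q ≤ n/(k+½)`, `k = 1, 2, 3`, are primes of `Φ_n` (`n ≥ 161`) -/

/-- `log Φ_n = Σ_{q ∈ Φ-primes} log q`. [cite: Lai2025TwoAdicZeta, Lemma 5.1 (proof: "log Φ_n = Σ … log q")] -/
theorem log_PhiL (n : ℕ) : Real.log (PhiL n : ℝ) = ∑ q ∈ phiPrimes n, Real.log (q : ℝ) := by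
  rw [PhiL, Nat.cast_prod, Real.log_prod]
  intro q hq
  exact_mod_cast (mem_phiPrimes.1 hq).2.1.ne_zero

/-- **The class-`k` primes are primes of `Φ_n`** («`L_n = Σ_{k=1}^{∞} Σ_{n/(k+1) < q < n/(k+½)} log q`», and the cut-off
`q > √(10n)` is automatic for `k ≤ 3`, `n ≥ 161`): for `1 ≤ k ≤ 3`, `n ≥ 161`, a prime `q` with `n/(k+1) < q ≤ n/(k+½)`
satisfies `q ≤ n`, `q² > 10n` and `{n/q} > ½` (i.e. `q < 2(n mod q)`).
[cite: Lai2025TwoAdicZeta, Lemma 5.1 (proof)] -/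
theorem mem_phiPrimes_of_class {n k q : ℕ} (hn : 161 ≤ n) (hk1 : 1 ≤ k) (hk3 : k ≤ 3) (hq : q.Prime)
    (h1 : (n : ℝ) / (k + 1) < q) (h2 : (q : ℝ) ≤ (n : ℝ) / (k + 1 / 2)) : q ∈ phiPrimes n := by
  have hk1' : (0 : ℝ) < k + 1 := by positivity
  have hk2' : (0 : ℝ) < k + 1 / 2 := by positivity
  -- the two defining inequalities, in integers (`kq` is an atom for `omega`)
  have hA : n < k * q + q := by
    have h : (n : ℝ) < q * (k + 1) := by rwa [div_lt_iff₀ hk1'] at h1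
    have h' : (n : ℝ) < (k * q + q : ℕ) := by push_cast; linarith
    exact_mod_cast h'
  have hB : 2 * (k * q) + q ≤ 2 * n := by
    have h : (q : ℝ) * (k + 1 / 2) ≤ n := by rwa [le_div_iff₀ hk2'] at h2
    have h' : ((2 * (k * q) + q : ℕ) : ℝ) ≤ (2 * n : ℕ) := by push_cast; linarith
    exact_mod_cast h'
  have hk3q : k * q ≤ 3 * q := Nat.mul_le_mul_right q hk3
  have hk1q : 1 * q ≤ k * q := Nat.mul_le_mul_right q hk1
  have hq41 : 41 ≤ q := by omega
  -- `n mod q = n − kq`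
  have hmod : n % q = n - k * q := by
    have e : (n - k * q + k * q) % q = (n - k * q) % q := Nat.add_mul_mod_self_right _ _ _
    rw [Nat.sub_add_cancel (by omega)] at e
    rw [e, Nat.mod_eq_of_lt (by omega)]
  -- `q` is odd, so `2(n − kq) ≠ q`
  have hne : q ≠ 2 * (n - k * q) := by
    intro e
    have h2 : 2 ∣ q := ⟨n - k * q, by omega⟩
    have := (Nat.prime_dvd_prime_iff_eq Nat.prime_two hq).1 h2
    omega
  rw [mem_phiPrimes]
  refine ⟨by omega, hq, by nlinarith, ?_⟩
  rw [hmod]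
  omega

/-- **`log Φ_n ≥ Σ_{k=1}^{3} (θ(n/(k+½)) − θ(n/(k+1)))`** for `n ≥ 161` (the printed lower bound
`Σ_{k=1}^{K} Σ_{n/(k+1) < q < n/(k+½)} log q ≤ L_n` with `K = 3`, the classes being disjoint sets of primes of `Φ_n`).
[cite: Lai2025TwoAdicZeta, Lemma 5.1 (proof, the displayed sandwich with K = 3)] -/
theorem sum_classes_le_log_PhiL {n : ℕ} (hn : 161 ≤ n) :
    ∑ k ∈ Icc (1 : ℕ) 3, (Chebyshev.theta ((n : ℝ) / ((k : ℝ) + 1 / 2)) - Chebyshev.theta ((n : ℝ) / ((k : ℝ) + 1)))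
      ≤ Real.log (PhiL n : ℝ) := by
  classical
  set C : ℕ → Finset ℕ := fun k =>
    (Ioc ⌊(n : ℝ) / (k + 1)⌋₊ ⌊(n : ℝ) / (k + 1 / 2)⌋₊).filter Nat.Prime with hC
  have hclass : ∀ k : ℕ, Chebyshev.theta ((n : ℝ) / (k + 1 / 2)) - Chebyshev.theta ((n : ℝ) / (k + 1))
      = ∑ p ∈ C k, Real.log p := fun k =>
    Zudilin2004.PhiCert.theta_sub_theta
      (div_le_div_of_nonneg_left (Nat.cast_nonneg n) (by positivity) (by linarith))
  have hmemC : ∀ k p : ℕ, p ∈ C k ↔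
      p.Prime ∧ (n : ℝ) / (k + 1) < p ∧ (p : ℝ) ≤ (n : ℝ) / (k + 1 / 2) := by
    intro k p
    simp only [hC, mem_filter, mem_Ioc]
    rw [Nat.floor_lt (by positivity), Nat.le_floor_iff (by positivity)]
    tauto
  -- the classes are pairwise disjoint
  have key : ∀ k₁ k₂ : ℕ, k₁ < k₂ → Disjoint (C k₁) (C k₂) := by
    intro k₁ k₂ hlt
    refine Finset.disjoint_left.2 fun p hp1 hp2 => ?_
    obtain ⟨-, h1, -⟩ := (hmemC k₁ p).1 hp1
    obtain ⟨-, -, h2⟩ := (hmemC k₂ p).1 hp2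
    have hk : (k₁ : ℝ) + 1 ≤ k₂ := by exact_mod_cast hlt
    have hle : (n : ℝ) / (k₂ + 1 / 2) ≤ (n : ℝ) / (k₁ + 1) :=
      div_le_div_of_nonneg_left (Nat.cast_nonneg n) (by positivity) (by linarith)
    linarith
  have hdisj : Set.PairwiseDisjoint (↑(Icc (1 : ℕ) 3) : Set ℕ) C := by
    intro k₁ _ k₂ _ hne
    rcases lt_or_gt_of_ne hne with hlt | hlt
    · exact key _ _ hlt
    · exact (key _ _ hlt).symm
  rw [sum_congr rfl fun k _ => hclass k, ← sum_biUnion hdisj, log_PhiL]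
  refine sum_le_sum_of_subset_of_nonneg ?_ fun q hq _ => Real.log_nonneg ?_
  · intro p hp
    obtain ⟨k, hk, hpk⟩ := mem_biUnion.1 hp
    obtain ⟨hp', h1, h2⟩ := (hmemC k p).1 hpk
    have hk' := mem_Icc.1 hk
    exact mem_phiPrimes_of_class hn hk'.1 hk'.2 hp' h1 h2
  · exact_mod_cast (mem_phiPrimes.1 hq).2.1.one_lt.le

/-! ## §2. The prime number theorem on the three classes -/

/-- **PNT on the classes `k = 1, 2, 3`**: `(1/n) Σ_{k=1}^{3} (θ(n/(k+½)) − θ(n/(k+1))) → Σ_{k=1}^{3} (1/(k+½) − 1/(k+1))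
= 1/6 + 1/15 + 1/28 = 113/420` («Then (PNT) implies that `n Σ_{k=1}^{K}(1/(k+½) − 1/(k+1)) + o(n) ≤ L_n`»).
[cite: Lai2025TwoAdicZeta, Lemma 5.1 (proof)] -/
theorem tendsto_sum_classes_div :
    Tendsto (fun n : ℕ =>
        (∑ k ∈ Icc (1 : ℕ) 3, (Chebyshev.theta ((n : ℝ) / ((k : ℝ) + 1 / 2)) - Chebyshev.theta ((n : ℝ) / ((k : ℝ) + 1)))) / n)
      atTop (𝓝 (113 / 420)) := by
  have h : ∀ k : ℕ, Tendsto (fun n : ℕ =>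
      (Chebyshev.theta ((n : ℝ) / (k + 1 / 2)) - Chebyshev.theta ((n : ℝ) / (k + 1))) / n)
      atTop (𝓝 (1 / ((k : ℝ) + 1 / 2) - 1 / ((k : ℝ) + 1))) := fun k =>
    RhinViola.tendsto_theta_class_div (u := 1 / 2) (v := 1) (by norm_num) (by norm_num) k
  have hsum := tendsto_finsetSum (Icc (1 : ℕ) 3) fun k _ => h k
  have hI : Icc (1 : ℕ) 3 = ({1, 2, 3} : Finset ℕ) := by
    ext a; simp only [mem_Icc, mem_insert, mem_singleton]; omega
  have hval : ∑ k ∈ Icc (1 : ℕ) 3, (1 / ((k : ℝ) + 1 / 2) - 1 / ((k : ℝ) + 1)) = 113 / 420 := by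
    rw [hI, sum_insert (by simp), sum_insert (by simp), sum_singleton]
    push_cast
    norm_num
  rw [← hval]
  refine hsum.congr fun n => ?_
  rw [sum_div]

/-! ## §3. `Φ_n ≥ e^{n/4}` eventually -/

/-- **Lemma 5.1 (lower half, rate `¼ < 2 log 2 − 1`)**: `e^{n/4} ≤ Φ_n` for all sufficiently large `n`.
[cite: Lai2025TwoAdicZeta, Lemma 5.1] -/
theorem eventually_exp_le_PhiL : ∀ᶠ n : ℕ in atTop, Real.exp ((n : ℝ) / 4) ≤ (PhiL n : ℝ) := by
  have hlt : (1 / 4 : ℝ) < 113 / 420 := by norm_num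
  have hev := tendsto_sum_classes_div.eventually_const_lt hlt
  filter_upwards [hev, eventually_ge_atTop 161] with n h1 hn
  have hn0 : (0 : ℝ) < n := by exact_mod_cast (show 0 < n by omega)
  have hS := sum_classes_le_log_PhiL hn
  have h2 : (n : ℝ) / 4 ≤ Real.log (PhiL n : ℝ) := by
    rw [lt_div_iff₀ hn0] at h1
    linarith
  calc Real.exp ((n : ℝ) / 4) ≤ Real.exp (Real.log (PhiL n : ℝ)) := Real.exp_le_exp.2 h2
    _ = (PhiL n : ℝ) := Real.exp_log (by exact_mod_cast PhiL_pos n)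

/-- `e^{an/4} ≤ Φ_n^a` for all sufficiently large `n` (the form used for `Φ_n^{−(s+2)}` in the proof of Theorem 1.2).
[cite: Lai2025TwoAdicZeta, Lemma 5.1 with §7 (proof of Thm 1.2)] -/
theorem eventually_exp_mul_le_PhiL_pow (a : ℕ) :
    ∀ᶠ n : ℕ in atTop, Real.exp ((a : ℝ) * n / 4) ≤ (PhiL n : ℝ) ^ a := by
  filter_upwards [eventually_exp_le_PhiL] with n hn
  rw [show (a : ℝ) * n / 4 = a * ((n : ℝ) / 4) by ring, Real.exp_nat_mul]
  exact pow_le_pow_left₀ (Real.exp_pos _).le hn a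

end Literature.NumberTheory.Irrationality.Lai2025TwoAdic

end
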